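import Mathlib
import HarnessLib

/-! # Stub `helper_weightedMass_continuousOn` of line `Sketch` (crux `EntropyRung.ConicalGap`, stmt-SmoothPoincare4-16589)

Pure measure theory: continuity in the scale `τ ∈ (0, ∞)` of the three weighted masses

  `Z(τ) = ∫ e^{-f/τ} dμ`, `F(τ) = ∫ f e^{-f/τ} dμ`, `N(τ) = ∫ R e^{-f/τ} dμ`

of a measure space `(X, μ)` with measurable `f ≥ 0` and measurable `R`, assuming the three weights are
integrable for every `τ > 0` (on a gradient shrinking Ricci soliton this is Wang–Wang 2023,
arXiv:2308.06560, proof of Prop. 2.6; here it is a hypothesis). This is the input the fundamental theorem of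
calculus needs when the Wang–Wang ODE `d/dT (T⁻² ∫ e^{-f/T} dμ) = −(T − 1) T⁻⁴ ∫ R e^{-f/T} dμ` is integrated
exactly in `T`.

How: one parametrised lemma `weightedMass_continuousAt` for a general measurable weight `w` — at a scale
`τ₀ > 0`, dominated convergence (`MeasureTheory.continuousAt_of_dominated`) on the neighbourhood
`(τ₀/2, 2τ₀)` with the bound `|w| e^{-f/(2τ₀)}`, valid because `e^{-f/τ} ≤ e^{-f/(2τ₀)}` for `0 < τ < 2τ₀`
and `f ≥ 0` (`weightedMass_exp_le`), and integrable by the hypothesis at scale `2τ₀`; the integrand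
`τ ↦ w(x) e^{-f(x)/τ}` is continuous at `τ₀ ≠ 0`. The three clauses are the instances `w = 1, f, R`, and
`ContinuousOn` on `(0, ∞)` follows from `ContinuousAt` at every point (`continuousOn_of_forall_continuousAt`).

The hypothesis `R ≥ 0` is part of the registered signature but is not used (the bound takes `|R|`).
Everything here is proved; no definition and no named fact is introduced.
-/

noncomputable section

-- `Summit.SmoothPoincare4.SmoothPoincare4.…` (summit = problem) trips `dupNamespace` on every decl.
set_option linter.dupNamespace false

open scoped Topology
open MeasureTheory Set Filter

namespace Summit.SmoothPoincare4.SmoothPoincare4.Theorems.ConicalGapSketch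

/-- Monotonicity of the weight in the scale: for `a ≥ 0` and `0 < τ ≤ σ`, `e^{-a/τ} ≤ e^{-a/σ}`. -/
theorem weightedMass_exp_le {a τ σ : ℝ} (ha : 0 ≤ a) (hτ : 0 < τ) (hτσ : τ ≤ σ) :
    Real.exp (-a / τ) ≤ Real.exp (-a / σ) := by
  refine Real.exp_le_exp.2 ?_
  rw [neg_div, neg_div]
  exact neg_le_neg (div_le_div_of_nonneg_left ha hτ hτσ)

/-- **Scale-continuity of a weighted mass** (dominated convergence): for measurable `f ≥ 0`, a measurable
weight `w` and a scale `τ₀ > 0` with `w e^{-f/(2τ₀)}` integrable, the weighted mass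
`τ ↦ ∫ w e^{-f/τ} dμ` is continuous at `τ₀`. The dominating function on the neighbourhood `(τ₀/2, 2τ₀)`
is `|w| e^{-f/(2τ₀)}`. -/
theorem weightedMass_continuousAt {X : Type*} [MeasurableSpace X] {μ : Measure X} {f w : X → ℝ}
    (hf : Measurable f) (hw : Measurable w) (hf0 : ∀ x, 0 ≤ f x) {τ₀ : ℝ} (hτ₀ : 0 < τ₀)
    (hInt : Integrable (fun x ↦ w x * Real.exp (-f x / (2 * τ₀))) μ) :
    ContinuousAt (fun τ : ℝ ↦ ∫ x, w x * Real.exp (-f x / τ) ∂μ) τ₀ := by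
  have hmem : Ioo (τ₀ / 2) (2 * τ₀) ∈ 𝓝 τ₀ := Ioo_mem_nhds (by linarith) (by linarith)
  refine continuousAt_of_dominated (bound := fun x ↦ |w x| * Real.exp (-f x / (2 * τ₀))) ?_ ?_ ?_ ?_
  · exact Eventually.of_forall fun τ ↦
      (hw.mul (hf.neg.div_const τ).exp).aestronglyMeasurable
  · filter_upwards [hmem] with τ hτ
    refine Eventually.of_forall fun x ↦ ?_
    rw [norm_mul, Real.norm_eq_abs, Real.norm_eq_abs, Real.abs_exp]
    have hτpos : 0 < τ := lt_trans (by linarith) hτ.1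
    exact mul_le_mul_of_nonneg_left (weightedMass_exp_le (hf0 x) hτpos hτ.2.le) (abs_nonneg _)
  · refine hInt.abs.congr (Eventually.of_forall fun x ↦ ?_)
    simp only [abs_mul, Real.abs_exp]
  · refine Eventually.of_forall fun x ↦ ?_
    have h1 : ContinuousAt (fun τ : ℝ ↦ -f x / τ) τ₀ :=
      continuousAt_const.div continuousAt_id hτ₀.ne'
    exact h1.rexp.const_mul (w x)

/-- **Helper H2 of line `Sketch`** (scale-continuity of the weighted masses; pure measure theory): for any
measure `μ`, measurable `f, R ≥ 0` with `e^{-f/τ}`, `f e^{-f/τ}`, `R e^{-f/τ}` integrable for every `τ > 0`,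
the three weighted masses `τ ↦ ∫ e^{-f/τ} dμ`, `τ ↦ ∫ f e^{-f/τ} dμ`, `τ ↦ ∫ R e^{-f/τ} dμ` are continuous
on `(0, ∞)`. -/
theorem helper_weightedMass_continuousOn : ∀ (X : Type) [MeasurableSpace X] (μ : MeasureTheory.Measure X) (f R : X → ℝ), Measurable f → Measurable R → (∀ x, 0 ≤ f x) → (∀ x, 0 ≤ R x) → (∀ τ : ℝ, 0 < τ → MeasureTheory.Integrable (fun x ↦ Real.exp (-f x / τ)) μ ∧ MeasureTheory.Integrable (fun x ↦ f x * Real.exp (-f x / τ)) μ ∧ MeasureTheory.Integrable (fun x ↦ R x * Real.exp (-f x / τ)) μ) → ContinuousOn (fun τ : ℝ ↦ ∫ x, Real.exp (-f x / τ) ∂μ) (Set.Ioi 0) ∧ ContinuousOn (fun τ : ℝ ↦ ∫ x, f x * Real.exp (-f x / τ) ∂μ) (Set.Ioi 0) ∧ ContinuousOn (fun τ : ℝ ↦ ∫ x, R x * Real.exp (-f x / τ) ∂μ) (Set.Ioi 0) := by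
  intro X _ μ f R hf hR hf0 _ hInt
  have h2 : ∀ τ₀ ∈ Ioi (0 : ℝ), (0 : ℝ) < 2 * τ₀ := fun τ₀ hτ₀ ↦ by
    have : (0 : ℝ) < τ₀ := hτ₀
    positivity
  refine ⟨?_, ?_, ?_⟩
  · refine continuousOn_of_forall_continuousAt fun τ₀ hτ₀ ↦ ?_
    have h1 : Integrable (fun x ↦ (1 : ℝ) * Real.exp (-f x / (2 * τ₀))) μ := by
      simpa only [one_mul] using (hInt _ (h2 τ₀ hτ₀)).1
    simpa only [one_mul] using
      weightedMass_continuousAt (w := fun _ ↦ (1 : ℝ)) hf measurable_const hf0 hτ₀ h1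
  · exact continuousOn_of_forall_continuousAt fun τ₀ hτ₀ ↦
      weightedMass_continuousAt hf hf hf0 hτ₀ (hInt _ (h2 τ₀ hτ₀)).2.1
  · exact continuousOn_of_forall_continuousAt fun τ₀ hτ₀ ↦
      weightedMass_continuousAt hf hR hf0 hτ₀ (hInt _ (h2 τ₀ hτ₀)).2.2

end Summit.SmoothPoincare4.SmoothPoincare4.Theorems.ConicalGapSketch

end
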